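import Mathlib.Topology.MetricSpace.HausdorffDimension
import Mathlib.LinearAlgebra.Complex.FiniteDimensional
import Literature.Probability.RandomPlanarGeometry.CritPercSLE
import Literature.Probability.RandomPlanarGeometry.CritPercSLESpaceFilling
import Literature.Probability.Process.KolmogorovExtensionProofs
import HarnessLib

/-!
# The dimension of the SLE trace (Beffara 2008): the printed proof architecture, proved glue

The named fact `Literature.Probability.RandomPlanarGeometry.ae_dimH_range_sleTrace` of
`CritPercSLE.lean` (**crit-perc.S20**: for `0 < κ ≤ 8`, almost surely
`dim_H γ[0, ∞) = 1 + κ / 8` for the chordal SLE_κ trace `γ = sleTrace κ ω`) is the case `κ ≤ 8`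
of the main theorem of V. Beffara, *The dimension of the SLE curves*, Ann. Probab. 36 (2008)
1421–1452 (the **unnumbered Theorem of the Introduction**, p. 1422; arXiv:math/0211322v3 p. 2):

> "Theorem. Let `(K_t)` be an SLE_κ in the upper-half plane with `κ > 0`, let `γ` be its trace
> and let `H := γ([0, ∞))`. Then, almost surely, `dim_H(H) = 2 ∧ (1 + κ/8)`."

This file does **not** discharge the fact (the proof is the whole paper together with the
Rohde–Schramm theory; no new named fact is introduced here, D-0026). It PROVES the glue of the
printed proof, i.e. the reduction of `ae_dimH_range_sleTrace` to the two intermediate statements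
Beffara prints in §1 and to the space-filling phase, so that a later split / discharge only has
to supply those inputs:

* **§1, p. 1425** (arXiv p. 5): "The next two sections contain derivations of conditions 1
  and 3; together with Proposition 1, this implies that `P(dim_H H = 1 + κ/8) > 0`." — for
  `0 < κ < 8` (Prop. 4 is stated for `κ ∈ (0, 8)`, and §3 opens with "In this whole section we
  shall assume that `κ < 8` (there is nothing to prove if `κ ≥ 8`, since in that case `γ` is
  space-filling)"). This is hypothesis `hpos` below, stated literally:
  `0 < P {ω | dim_H γ_ω[0, ∞) = 1 + κ/8}`.
* **Lemma 3** (0–1 law for the trace, from Beffara, Ann. Probab. 32 (2004)): "For all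
  `d ∈ [0, 2]`, we have `P(dim_H H = d) ∈ {0, 1}`." This is hypothesis `h01` below, in the
  null-set form "the event or its complement is `P`-null", i.e.
  `(a.s. dim_H = d) ∨ (a.s. dim_H ≠ d)` (for an event of the probability space this is exactly
  `P(E) ∈ {0, 1}`; the null-set form avoids the measurability of `ω ↦ dim_H γ_ω[0, ∞)`).
* **`κ = 8`**: "This result was known for `κ ≥ 8` (because the curve is then space-filling)"
  (p. 1422) — the existing named fact `ae_isSpaceFilling_sleTrace_of_eight_le`
  (Rohde–Schramm (2005), Cor. 7.4 with its Update; reduced to the Rohde–Schramm inputs in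
  `CritPercSLESpaceFilling.lean`) and the computation `dim_H (closure ℍ) = 2`
  (`Literature.Probability.RandomPlanarGeometry.dimH_closure_upperHalfPlaneSet`, proved from Mathlib's
  `Real.dimH_of_mem_nhds`).

Proved here:

* `dimH_closure_upperHalfPlaneSet`, `Loewner.IsSpaceFilling.dimH_range_eq` (deterministic);
* `ae_dimH_range_sleTrace_eight_of_isSpaceFilling` — the case `κ = 8` of the fact from the
  space-filling phase alone;
* `ae_dimH_range_sleTrace_of_pos_of_zero_one` — **the glue**: `hpos`, `h01` and the
  space-filling phase at `κ = 8` imply `ae_dimH_range_sleTrace` for every `κ` (the last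
  paragraph of Beffara's §1: positive probability and the 0–1 law give probability one);
* `ae_dimH_range_sleTrace_of_pos_of_zero_one'` — the same with the `κ = 8` input replaced by
  the Rohde–Schramm / Lawler–Schramm–Werner root facts through
  `ae_isSpaceFilling_sleTrace_of_eight_le_of_facts`;
* consistency (`measure_dimH_range_sleTrace_pos_of_ae`, `dimH_range_sleTrace_zero_one_of_ae`):
  conversely both hypotheses follow from the fact itself (and, for `κ > 8` in the 0–1 law, from
  the space-filling phase), so the reduction does not replace the fact by stronger statements.
  The first uses that the pre-Wiener measure is a probability measure, now unconditional
  (`Literature.Probability.Process.exists_isProjectiveLimit_holds`, Kolmogorov extension).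

Not used by Beffara's printed proof and therefore not restated: Rohde–Schramm (2005), Thm 8.1
(expected covering numbers of `γ[0, ∞) ∩ A`) and its Cor. 8.2 (a.s. `dim_H γ[0, ∞) ≤ 1 + κ/8`
for `κ < 8`); Beffara's Prop. 1(1) re-derives the upper bound.

A second reduction (last section) routes the upper bound through Rohde–Schramm's Cor. 8.2
instead: `ae_dimH_range_sleTrace_of_ae_le_of_pos_of_zero_one` derives the fact from (`hU`) the
a.s. upper bound `dim_H γ[0, ∞) ≤ 1 + κ/8` (Rohde–Schramm (2005), Cor. 8.2), (`hL`) the lower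
bound with positive probability `P(dim_H γ[0, ∞) ≥ 1 + κ/8) > 0` (the lower half of Beffara's
§1 display; Prop. 1 with the one- and two-point estimates, for which Lawler (2005), Thm 7.9 and
Lawler–Werness (2013), Thm 2 are independent sources), `h01` and `hSF`; the combination step
`measure_setOf_dimH_eq_pos_of_ae_le` is pure (outer) measure theory, and both new inputs again
follow from the fact (`ae_dimH_range_sleTrace_le_of_ae`, `measure_dimH_range_sleTrace_ge_pos_of_ae`).

## Mathlib

We USE `dimH`, `Real.dimH_of_mem_nhds` (a neighbourhood in a finite-dimensional real normed
space has full Hausdorff dimension), `Complex.finrank_real_complex`, `MeasureTheory.ae_iff`,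
`MeasureTheory.measure_mono_ae`. Mathlib has no SLE (searched `Loewner`, `SLE`, `Beffara`).

## References

* V. Beffara, *The dimension of the SLE curves*, Ann. Probab. 36 (2008) 1421–1452,
  doi:10.1214/07-AOP364, arXiv:math/0211322v3: Theorem (Introduction), §1 (Prop. 1, Lemma 3 and
  the display between them), Prop. 4, Cor. 5, §3 (main estimate (3.5), §3.2).
* V. Beffara, *Hausdorff dimensions for SLE₆*, Ann. Probab. 32 (2004) 2606–2629 (the 0–1 law).
* S. Rohde, O. Schramm, *Basic properties of SLE*, Ann. of Math. 161 (2005) 883–924: Cor. 7.4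
  and Update (space-filling phase), Thm 8.1 and Cor. 8.2 (upper bound).
* G. F. Lawler, *Conformally Invariant Processes in the Plane*, AMS (2005): Thm 7.9 (one-point
  estimate), Lemma A.4 and Remark A.5 (energy method).
* G. F. Lawler, B. M. Werness, *Multi-point Green's functions for SLE and an estimate of
  Beffara*, Ann. Probab. 41 (2013) 1513–1555, arXiv:1011.3551: Thm 2 (Beffara's estimate).
-/

noncomputable section

open Set Filter Topology MeasureTheory
open UpperHalfPlane (upperHalfPlaneSet isOpen_upperHalfPlaneSet)
open scoped NNReal ENNReal

namespace Literature.Probability.RandomPlanarGeometry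

/-! ### Deterministic: the closed half-plane has Hausdorff dimension `2` -/

/-- The closed upper half-plane `closure ℍ ⊆ ℂ` has Hausdorff dimension `2`: it is a
neighbourhood of `i`, and a neighbourhood in the real normed space `ℂ` (`finrank ℝ ℂ = 2`) has
full dimension (Mathlib `Real.dimH_of_mem_nhds`). [folklore] -/
theorem dimH_closure_upperHalfPlaneSet : dimH (closure upperHalfPlaneSet) = 2 := by
  have hI : Complex.I ∈ upperHalfPlaneSet := by
    show 0 < Complex.I.im
    simp
  have h : closure upperHalfPlaneSet ∈ 𝓝 Complex.I :=
    mem_of_superset (isOpen_upperHalfPlaneSet.mem_nhds hI) subset_closure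
  rw [Real.dimH_of_mem_nhds h, Complex.finrank_real_complex, Nat.cast_ofNat]

/-- A space-filling curve (`Loewner.IsSpaceFilling γ`: `γ[0, ∞) = closure ℍ`) has range of
Hausdorff dimension `2`. This is the sentence "This result was known for `κ ≥ 8` (because the
curve is then space-filling)" of Beffara (2008), p. 1422. [folklore] -/
theorem Loewner.IsSpaceFilling.dimH_range_eq {γ : ℝ≥0 → ℂ} (h : Loewner.IsSpaceFilling γ) :
    dimH (range γ) = 2 := by
  have h' : range γ = closure upperHalfPlaneSet := h
  rw [h', dimH_closure_upperHalfPlaneSet]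

/-- Arithmetic in `ℝ≥0∞`: `1 + 8 / 8 = 2` for the `ℝ≥0`-numeral `8` cast to `ℝ≥0∞` (the value
`1 + κ/8` of the dimension at `κ = 8`). [folklore] -/
theorem one_add_coe_eight_div_eight : 1 + ((8 : ℝ≥0) : ℝ≥0∞) / 8 = 2 := by
  rw [ENNReal.coe_ofNat, ENNReal.div_self (by norm_num) (by norm_num), one_add_one_eq_two]

/-- For `κ ≤ 8` the dimension value `1 + κ/8` is at most `2` (so that Beffara's Lemma 3, stated
for `d ∈ [0, 2]`, applies to `d = 1 + κ/8`). [folklore] -/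
theorem one_add_coe_div_eight_le_two {κ : ℝ≥0} (hκ : κ ≤ 8) : 1 + (κ : ℝ≥0∞) / 8 ≤ 2 := by
  calc 1 + (κ : ℝ≥0∞) / 8 ≤ 1 + ((8 : ℝ≥0) : ℝ≥0∞) / 8 :=
        add_le_add le_rfl (ENNReal.div_le_div_right
          (show (κ : ℝ≥0∞) ≤ ((8 : ℝ≥0) : ℝ≥0∞) from ENNReal.coe_le_coe.2 hκ) 8)
    _ = 2 := one_add_coe_eight_div_eight

/-! ### The case `κ = 8` from the space-filling phase -/

section CritPerc

/-- **The case `κ = 8` of `ae_dimH_range_sleTrace`** from the space-filling phase alone: if the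
SLE₈ trace is almost surely space-filling (the named fact `ae_isSpaceFilling_sleTrace_of_eight_le`
at `κ = 8`, Rohde–Schramm (2005), Cor. 7.4 with its Update; hypothesis `hSF`), then almost surely
`dim_H γ[0, ∞) = 2 = 1 + 8/8`. Beffara (2008), p. 1422 ("known for `κ ≥ 8` because the curve is
then space-filling") and §3 ("nothing to prove if `κ ≥ 8`"). [cite: Beffara2008, Theorem (Introduction), case κ ≥ 8] -/
theorem ae_dimH_range_sleTrace_eight_of_isSpaceFilling
    (hSF : ae_isSpaceFilling_sleTrace_of_eight_le (κ := 8)) :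
    ae_dimH_range_sleTrace (κ := 8) := by
  intro _ _
  filter_upwards [hSF le_rfl] with ω hω
  rw [hω.dimH_range_eq, one_add_coe_eight_div_eight]

/-! ### The glue of Beffara's proof: positive probability and the 0–1 law -/

/-- **Beffara's concluding argument** (Beffara (2008), §1, p. 1425: "… this implies that
`P(dim_H H = 1 + κ/8) > 0`. The main theorem then follows from the zero-one law derived in [2],
namely: Lemma 3 (0–1 law for the trace). For all `d ∈ [0, 2]`, we have
`P(dim_H H = d) ∈ {0, 1}`"), for one value `κ < 8`... stated for a general `d`: if the event
`{dim_H γ[0, ∞) = d}` has positive probability (`hpos`) and it or its complement is null (`h01`),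
then almost surely `dim_H γ[0, ∞) = d`. Pure measure theory (`ae_iff`), no measurability needed.
[cite: Beffara2008, §1 (p. 1425, proof of the Theorem from Prop. 1 and Lemma 3)] -/
theorem ae_dimH_range_sleTrace_eq_of_measure_pos {κ : ℝ≥0} {d : ℝ≥0∞}
    (hpos : 0 < Process.preWienerMeasure {ω | dimH (range (sleTrace κ ω)) = d})
    (h01 : (∀ᵐ ω ∂Process.preWienerMeasure, dimH (range (sleTrace κ ω)) = d) ∨
      ∀ᵐ ω ∂Process.preWienerMeasure, dimH (range (sleTrace κ ω)) ≠ d) :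
    ∀ᵐ ω ∂Process.preWienerMeasure, dimH (range (sleTrace κ ω)) = d := by
  rcases h01 with h | h
  · exact h
  · have h0 : Process.preWienerMeasure {ω | dimH (range (sleTrace κ ω)) = d} = 0 := by
      have h' := ae_iff.1 h
      simpa only [ne_eq, not_not] using h'
    exact absurd h0 hpos.ne'

/-- **`ae_dimH_range_sleTrace` from the two statements of Beffara's §1 and the space-filling
phase** (the architecture of the printed proof of the Theorem of Beffara (2008)):

* `hpos` — Beffara (2008), §1, p. 1425 (from Prop. 1 with the first-moment estimate Prop. 4 /
  Cor. 5 of §2 and the second-moment estimate of §3, main estimate (3.5)): for `0 < κ < 8`,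
  `P(dim_H γ[0, ∞) = 1 + κ/8) > 0`;
* `h01` — Beffara (2008), Lemma 3 (0–1 law for the trace, from Beffara (2004)): for `κ > 0` and
  `d ∈ [0, 2]`, `P(dim_H γ[0, ∞) = d) ∈ {0, 1}`, in the null-set form "almost surely
  `dim_H = d`, or almost surely `dim_H ≠ d`";
* `hSF` — the space-filling phase at `κ = 8` (`ae_isSpaceFilling_sleTrace_of_eight_le`,
  Rohde–Schramm (2005), Cor. 7.4 and Update), used for `κ = 8` exactly as in the paper ("there
  is nothing to prove if `κ ≥ 8`, since in that case `γ` is space-filling", §3).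

For `κ < 8` apply `ae_dimH_range_sleTrace_eq_of_measure_pos` with `d = 1 + κ/8 ≤ 2`; for `κ = 8`
use `ae_dimH_range_sleTrace_eight_of_isSpaceFilling`.
[cite: Beffara2008, Theorem (Introduction) and §1 p. 1425, Lemma 3] -/
theorem ae_dimH_range_sleTrace_of_pos_of_zero_one
    (hpos : ∀ {κ : ℝ≥0}, 0 < κ → κ < 8 →
      0 < Process.preWienerMeasure {ω | dimH (range (sleTrace κ ω)) = 1 + (κ : ℝ≥0∞) / 8})
    (h01 : ∀ {κ : ℝ≥0}, 0 < κ → ∀ {d : ℝ≥0∞}, d ≤ 2 →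
      (∀ᵐ ω ∂Process.preWienerMeasure, dimH (range (sleTrace κ ω)) = d) ∨
        ∀ᵐ ω ∂Process.preWienerMeasure, dimH (range (sleTrace κ ω)) ≠ d)
    (hSF : ae_isSpaceFilling_sleTrace_of_eight_le (κ := 8)) {κ : ℝ≥0} :
    ae_dimH_range_sleTrace (κ := κ) := by
  intro hκ0 hκ8
  rcases hκ8.lt_or_eq with hlt | rfl
  · exact ae_dimH_range_sleTrace_eq_of_measure_pos (hpos hκ0 hlt)
      (h01 hκ0 (one_add_coe_div_eight_le_two hκ8))
  · exact ae_dimH_range_sleTrace_eight_of_isSpaceFilling hSF hκ0 hκ8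

/-- The same glue with the `κ = 8` input traced back to the Rohde–Schramm / Lawler–Schramm–Werner
root facts of `SLE.lean` and `CritPercSLESpaceFilling.lean` (through
`ae_isSpaceFilling_sleTrace_of_eight_le_of_facts`): SLE₈ is generated by a curve
(`hasSLETrace_eight`, LSW (2004), Thm 4.7), the Rohde–Schramm theorem (`hasSLETrace_of_ne_eight`,
Thm 5.1), transience (`tendsto_norm_sleTrace_atTop`, Thm 7.1) and per-point density for `κ ≥ 8`
(`ae_infDist_sleTrace_eq_zero_of_eight_le`, Lemma 6.3 with eq. (6.2)).
[cite: Beffara2008, Theorem (Introduction) and §1 p. 1425, Lemma 3] -/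
theorem ae_dimH_range_sleTrace_of_pos_of_zero_one'
    (hpos : ∀ {κ : ℝ≥0}, 0 < κ → κ < 8 →
      0 < Process.preWienerMeasure {ω | dimH (range (sleTrace κ ω)) = 1 + (κ : ℝ≥0∞) / 8})
    (h01 : ∀ {κ : ℝ≥0}, 0 < κ → ∀ {d : ℝ≥0∞}, d ≤ 2 →
      (∀ᵐ ω ∂Process.preWienerMeasure, dimH (range (sleTrace κ ω)) = d) ∨
        ∀ᵐ ω ∂Process.preWienerMeasure, dimH (range (sleTrace κ ω)) ≠ d)
    (h8 : hasSLETrace_eight) (hne : hasSLETrace_of_ne_eight) (htr : tendsto_norm_sleTrace_atTop)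
    (hd : ae_infDist_sleTrace_eq_zero_of_eight_le) {κ : ℝ≥0} :
    ae_dimH_range_sleTrace (κ := κ) :=
  ae_dimH_range_sleTrace_of_pos_of_zero_one hpos h01
    (ae_isSpaceFilling_sleTrace_of_eight_le_of_facts h8 hne htr hd)

/-! ### Consistency: both hypotheses follow from the fact -/

/-- **Consistency, positive probability.** Conversely, the hypothesis `hpos` of
`ae_dimH_range_sleTrace_of_pos_of_zero_one` follows from `ae_dimH_range_sleTrace` itself: if almost
surely `dim_H γ[0, ∞) = 1 + κ/8`, that event has probability `1 > 0`. Uses that the pre-Wiener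
measure is a probability measure, unconditionally (Kolmogorov extension,
`Process.exists_isProjectiveLimit_holds`), and `measure_mono_ae` (no measurability needed).
[folklore] -/
theorem measure_dimH_range_sleTrace_pos_of_ae (h : ∀ κ : ℝ≥0, ae_dimH_range_sleTrace (κ := κ))
    {κ : ℝ≥0} (hκ0 : 0 < κ) (hκ8 : κ < 8) :
    0 < Process.preWienerMeasure {ω | dimH (range (sleTrace κ ω)) = 1 + (κ : ℝ≥0∞) / 8} := by
  haveI : IsProbabilityMeasure Process.preWienerMeasure :=
    Process.isProbabilityMeasure_preWienerMeasure
      (Process.isProjectiveLimit_preWienerMeasure_of Process.exists_isProjectiveLimit_holds)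
  have hae := h κ hκ0 hκ8.le
  have hle : Process.preWienerMeasure univ ≤
      Process.preWienerMeasure {ω | dimH (range (sleTrace κ ω)) = 1 + (κ : ℝ≥0∞) / 8} :=
    measure_mono_ae (hae.mono fun ω hω _ ↦ hω)
  rw [measure_univ] at hle
  exact one_pos.trans_le hle

/-- **Consistency, 0–1 law.** Conversely, the hypothesis `h01` of
`ae_dimH_range_sleTrace_of_pos_of_zero_one` (for every `κ > 0` and every `d`) follows from
`ae_dimH_range_sleTrace` (`κ ≤ 8`) and the space-filling phase (`κ ≥ 8`, dimension `2`): in both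
ranges the dimension is almost surely a constant `D`, and then for `d = D` the first, for
`d ≠ D` the second alternative holds. [folklore] -/
theorem dimH_range_sleTrace_zero_one_of_ae (h : ∀ κ : ℝ≥0, ae_dimH_range_sleTrace (κ := κ))
    (hSF : ∀ κ : ℝ≥0, ae_isSpaceFilling_sleTrace_of_eight_le (κ := κ)) {κ : ℝ≥0} (hκ0 : 0 < κ)
    (d : ℝ≥0∞) :
    (∀ᵐ ω ∂Process.preWienerMeasure, dimH (range (sleTrace κ ω)) = d) ∨
      ∀ᵐ ω ∂Process.preWienerMeasure, dimH (range (sleTrace κ ω)) ≠ d := by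
  obtain ⟨D, hD⟩ : ∃ D : ℝ≥0∞, ∀ᵐ ω ∂Process.preWienerMeasure, dimH (range (sleTrace κ ω)) = D := by
    rcases le_or_gt κ 8 with hle | hlt
    · exact ⟨_, h κ hκ0 hle⟩
    · exact ⟨2, (hSF κ hlt.le).mono fun ω hω ↦ hω.dimH_range_eq⟩
  by_cases hdD : D = d
  · exact Or.inl (hdD ▸ hD)
  · refine Or.inr (hD.mono fun ω hω ↦ ?_)
    rw [hω]
    exact hdD


/-! ### A second reduction: Rohde–Schramm's upper bound and a lower bound with positive probability

The architecture above follows Beffara's §1 literally (`hpos`: `P(dim_H = 1 + κ/8) > 0`). The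
upper half of that event is an independent published result: Rohde–Schramm (2005), **Cor. 8.2**
(arXiv Cor. 25, p. 920 of the journal: "For `κ < 8`, the Hausdorff dimension of `γ[0, ∞)` is
a.s. bounded above by `1 + κ/8`", an immediate consequence of the covering estimate Thm 8.1,
itself proved from Lemma 6.3, which assumes `κ > 0`). Splitting `hpos` accordingly gives the
reduction `ae_dimH_range_sleTrace_of_ae_le_of_pos_of_zero_one` of the fact to

* `hU` — Rohde–Schramm (2005), Cor. 8.2: for `0 < κ < 8`, almost surely
  `dim_H γ[0, ∞) ≤ 1 + κ/8`;
* `hL` — the lower bound with positive probability: for `0 < κ < 8`,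
  `P(dim_H γ[0, ∞) ≥ 1 + κ/8) > 0`. This is the lower half of Beffara's display "this implies
  that `P(dim_H H = 1 + κ/8) > 0`" (§1, p. 1425), i.e. the conclusion of his Prop. 1 (second
  moment / energy method, cf. Lawler (2005), Lemma A.4 and Remark A.5) fed with the one-point
  estimate (Beffara Prop. 4 / Cor. 5; independently Lawler (2005), Thm 7.9:
  `c' ε^{1-κ/8} ≤ P{Δ_x ≤ ε} ≤ c ε^{1-κ/8}`, `Δ_x = dist(x + i, γ[0, ∞) ∪ ℝ)`, `κ < 8`) and the
  two-point estimate (Beffara §3, (3.5); independently Lawler–Werness, Ann. Probab. 41 (2013),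
  Thm 2 "Beffara's estimate": `P{Υ_∞(z) < ε, Υ_∞(w) < δ} ≤ c ε^{2-d} δ^{2-d} |z - w|^{d-2}` for
  `Im z, Im w ≥ 1`, `d = 1 + κ/8`);
* `h01`, `hSF` — as above (Beffara's Lemma 3; the space-filling phase at `κ = 8`).

The measure theory of the step (`measure_setOf_dimH_eq_pos_of_ae_le`): if almost surely
`dim_H ≤ d` and `P(dim_H ≥ d) > 0` then `P(dim_H = d) > 0`, by subadditivity of the (outer)
measure — no measurability of `ω ↦ dim_H γ_ω[0, ∞)` is needed. Conversely `hU` and `hL` follow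
from the fact (`ae_dimH_range_sleTrace_le_of_ae`, `measure_dimH_range_sleTrace_ge_pos_of_ae`), so
this reduction does not replace the fact by stronger statements either. No new named fact is
introduced (D-0026); the inputs enter as hypotheses. -/

/-- **Positive probability of the exact dimension from an a.s. upper bound and a lower bound with
positive probability.** If almost surely `dim_H γ[0, ∞) ≤ d` (`hU`) and
`P(dim_H γ[0, ∞) ≥ d) > 0` (`hL`), then `P(dim_H γ[0, ∞) = d) > 0`:
`{d ≤ dim_H} ⊆ {dim_H = d} ∪ {d < dim_H}` and the second set is null by `hU`; subadditivity of
the outer measure (`measure_union_le`), no measurability needed. This is how Rohde–Schramm's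
Cor. 8.2 and the lower half of Beffara's Prop. 1 combine to Beffara's display
"`P(dim_H H = 1 + κ/8) > 0`" (Beffara (2008), §1, p. 1425). [folklore] -/
theorem measure_setOf_dimH_eq_pos_of_ae_le {κ : ℝ≥0} {d : ℝ≥0∞}
    (hU : ∀ᵐ ω ∂Process.preWienerMeasure, dimH (range (sleTrace κ ω)) ≤ d)
    (hL : 0 < Process.preWienerMeasure {ω | d ≤ dimH (range (sleTrace κ ω))}) :
    0 < Process.preWienerMeasure {ω | dimH (range (sleTrace κ ω)) = d} := by
  have hnull : Process.preWienerMeasure {ω | d < dimH (range (sleTrace κ ω))} = 0 := by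
    have h' := ae_iff.1 hU
    simpa only [not_le] using h'
  have hsub : {ω | d ≤ dimH (range (sleTrace κ ω))} ⊆
      {ω | dimH (range (sleTrace κ ω)) = d} ∪ {ω | d < dimH (range (sleTrace κ ω))} := by
    intro ω hω
    rcases (show d ≤ dimH (range (sleTrace κ ω)) from hω).eq_or_lt with h | h
    · exact Or.inl h.symm
    · exact Or.inr h
  have hle : Process.preWienerMeasure {ω | d ≤ dimH (range (sleTrace κ ω))} ≤
      Process.preWienerMeasure {ω | dimH (range (sleTrace κ ω)) = d} :=
    calc Process.preWienerMeasure {ω | d ≤ dimH (range (sleTrace κ ω))}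
        ≤ Process.preWienerMeasure
            ({ω | dimH (range (sleTrace κ ω)) = d} ∪ {ω | d < dimH (range (sleTrace κ ω))}) :=
          measure_mono hsub
      _ ≤ Process.preWienerMeasure {ω | dimH (range (sleTrace κ ω)) = d} +
            Process.preWienerMeasure {ω | d < dimH (range (sleTrace κ ω))} :=
          measure_union_le _ _
      _ = Process.preWienerMeasure {ω | dimH (range (sleTrace κ ω)) = d} := by
          rw [hnull, add_zero]
  exact hL.trans_le hle

/-- **`ae_dimH_range_sleTrace` from Rohde–Schramm's upper bound, the lower bound with positive
probability, the 0–1 law and the space-filling phase.**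

* `hU` — Rohde–Schramm, Ann. Math. 161 (2005), Cor. 8.2 (of Thm 8.1; Lemma 6.3 assumes
  `κ > 0`): for `0 < κ < 8`, almost surely `dim_H γ[0, ∞) ≤ 1 + κ/8`;
* `hL` — for `0 < κ < 8`, `P(dim_H γ[0, ∞) ≥ 1 + κ/8) > 0`: the lower half of Beffara (2008),
  §1, p. 1425 ("`P(dim_H H = 1 + κ/8) > 0`", from Prop. 1 with the one-point estimate Prop. 4 /
  Cor. 5 — independently Lawler (2005), Thm 7.9 — and the two-point estimate (3.5) —
  independently Lawler–Werness (2013), Thm 2);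
* `h01` — Beffara (2008), Lemma 3 (0–1 law, from Beffara (2004)), null-set form;
* `hSF` — `ae_isSpaceFilling_sleTrace_of_eight_le` at `κ = 8` (Rohde–Schramm (2005), Cor. 7.4
  and Update).

For `κ < 8`: `measure_setOf_dimH_eq_pos_of_ae_le` then `ae_dimH_range_sleTrace_eq_of_measure_pos`;
for `κ = 8`: `ae_dimH_range_sleTrace_eight_of_isSpaceFilling`.
[cite: Beffara2008, Theorem (Introduction), §1 p. 1425 and Lemma 3; RohdeSchramm2005, Cor. 8.2] -/
theorem ae_dimH_range_sleTrace_of_ae_le_of_pos_of_zero_one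
    (hU : ∀ {κ : ℝ≥0}, 0 < κ → κ < 8 →
      ∀ᵐ ω ∂Process.preWienerMeasure, dimH (range (sleTrace κ ω)) ≤ 1 + (κ : ℝ≥0∞) / 8)
    (hL : ∀ {κ : ℝ≥0}, 0 < κ → κ < 8 →
      0 < Process.preWienerMeasure {ω | 1 + (κ : ℝ≥0∞) / 8 ≤ dimH (range (sleTrace κ ω))})
    (h01 : ∀ {κ : ℝ≥0}, 0 < κ → ∀ {d : ℝ≥0∞}, d ≤ 2 →
      (∀ᵐ ω ∂Process.preWienerMeasure, dimH (range (sleTrace κ ω)) = d) ∨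
        ∀ᵐ ω ∂Process.preWienerMeasure, dimH (range (sleTrace κ ω)) ≠ d)
    (hSF : ae_isSpaceFilling_sleTrace_of_eight_le (κ := 8)) {κ : ℝ≥0} :
    ae_dimH_range_sleTrace (κ := κ) :=
  ae_dimH_range_sleTrace_of_pos_of_zero_one
    (fun hκ0 hκ8 ↦ measure_setOf_dimH_eq_pos_of_ae_le (hU hκ0 hκ8) (hL hκ0 hκ8)) h01 hSF

/-- The same reduction with the `κ = 8` input traced back to the Rohde–Schramm /
Lawler–Schramm–Werner root facts (through `ae_isSpaceFilling_sleTrace_of_eight_le_of_facts`).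
[cite: Beffara2008, Theorem (Introduction), §1 p. 1425 and Lemma 3; RohdeSchramm2005, Cor. 8.2] -/
theorem ae_dimH_range_sleTrace_of_ae_le_of_pos_of_zero_one'
    (hU : ∀ {κ : ℝ≥0}, 0 < κ → κ < 8 →
      ∀ᵐ ω ∂Process.preWienerMeasure, dimH (range (sleTrace κ ω)) ≤ 1 + (κ : ℝ≥0∞) / 8)
    (hL : ∀ {κ : ℝ≥0}, 0 < κ → κ < 8 →
      0 < Process.preWienerMeasure {ω | 1 + (κ : ℝ≥0∞) / 8 ≤ dimH (range (sleTrace κ ω))})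
    (h01 : ∀ {κ : ℝ≥0}, 0 < κ → ∀ {d : ℝ≥0∞}, d ≤ 2 →
      (∀ᵐ ω ∂Process.preWienerMeasure, dimH (range (sleTrace κ ω)) = d) ∨
        ∀ᵐ ω ∂Process.preWienerMeasure, dimH (range (sleTrace κ ω)) ≠ d)
    (h8 : hasSLETrace_eight) (hne : hasSLETrace_of_ne_eight) (htr : tendsto_norm_sleTrace_atTop)
    (hd : ae_infDist_sleTrace_eq_zero_of_eight_le) {κ : ℝ≥0} :
    ae_dimH_range_sleTrace (κ := κ) :=
  ae_dimH_range_sleTrace_of_ae_le_of_pos_of_zero_one hU hL h01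
    (ae_isSpaceFilling_sleTrace_of_eight_le_of_facts h8 hne htr hd)

/-- **Consistency, upper bound.** Conversely, Rohde–Schramm's Cor. 8.2 in the form `hU` follows
from the fact: almost surely `dim_H = 1 + κ/8 ≤ 1 + κ/8`. [folklore] -/
theorem ae_dimH_range_sleTrace_le_of_ae (h : ∀ κ : ℝ≥0, ae_dimH_range_sleTrace (κ := κ))
    {κ : ℝ≥0} (hκ0 : 0 < κ) (hκ8 : κ < 8) :
    ∀ᵐ ω ∂Process.preWienerMeasure, dimH (range (sleTrace κ ω)) ≤ 1 + (κ : ℝ≥0∞) / 8 :=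
  (h κ hκ0 hκ8.le).mono fun _ hω ↦ hω.le

/-- **Consistency, lower bound with positive probability.** Conversely, `hL` follows from the
fact: almost surely `dim_H ≥ 1 + κ/8`, an event of probability `1 > 0` (the pre-Wiener measure
is a probability measure, `Process.exists_isProjectiveLimit_holds`; `measure_mono_ae`, no
measurability needed). [folklore] -/
theorem measure_dimH_range_sleTrace_ge_pos_of_ae (h : ∀ κ : ℝ≥0, ae_dimH_range_sleTrace (κ := κ))
    {κ : ℝ≥0} (hκ0 : 0 < κ) (hκ8 : κ < 8) :
    0 < Process.preWienerMeasure {ω | 1 + (κ : ℝ≥0∞) / 8 ≤ dimH (range (sleTrace κ ω))} := by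
  haveI : IsProbabilityMeasure Process.preWienerMeasure :=
    Process.isProbabilityMeasure_preWienerMeasure
      (Process.isProjectiveLimit_preWienerMeasure_of Process.exists_isProjectiveLimit_holds)
  have hae := h κ hκ0 hκ8.le
  have hle : Process.preWienerMeasure univ ≤
      Process.preWienerMeasure {ω | 1 + (κ : ℝ≥0∞) / 8 ≤ dimH (range (sleTrace κ ω))} :=
    measure_mono_ae (hae.mono fun ω hω _ ↦ hω.ge)
  rw [measure_univ] at hle
  exact one_pos.trans_le hle

end CritPerc

end Literature.Probability.RandomPlanarGeometry

end
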